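import Summits.AtomisticToContinuum.HydrodynamicLimit.Theorems.MourreKoopmanChargesLinearToEntropyInBandVisCoreNToolkitB
import Summits.AtomisticToContinuum.HydrodynamicLimit.Theorems.MourreKoopmanChargesLinearToEntropyInBandWindowClausePieces
import Literature.Analysis.FunctionSpaces.TorusCalculusProofs
import HarnessLib

/-!
# Route `MourreKoopmanCharges`, crux `LinearToEntropyInBand` (stmt-AtomisticToContinuum-17740), skeleton v8:
# stub 4a-ii, missing lemma M4a — the frozen split (pathwise bookkeeping identity on the good set)

Support file (`--supports stmt-AtomisticToContinuum-17740`; registered helper `stub_windowClauseFrozenSplit`; worker of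
lead prover-line-…-17740-c5-0, wave 4; plan `work/stubs/WINDOWCLAUSE-PLAN.md` § 1 (2), § 3 M4a).

With the profiles frozen at the window start `s` and the entropy-variable test fields
`(A₀, A, A₄) = (∇λ⁰, (∇(u_j/θ))_j, ∇(−θ⁻¹))`, the streaming integral over the window `[s, s + w]`,
`w = τ (N+1)^{-1/3}`, of the one-particle kinetic current `kin = ⟪A₀, v⟫ + Σ_j ⟪A_j, v⟫ v_j + ⟪A₄, v⟫ ‖v‖²/2`
(= the `v`-part of the streaming rate of the local-Gibbs exponent, M2 `…WindowClauseExponent`) plus the frozen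
collision sum `collisionSum K` equal
`w · visCoreN(A) + ∫ visFluxN(A) dr + ∫ Σ_(i invisible) kinᵢ dr + (collisionSum K − Σᶠ visCollN(A))`
(`frozen_split`, § 2): `visCoreN_eq` (toolkit A), the visible/invisible split of a one-particle sum
(`sum_eq_sum_visible_add_sum_invisible`, `…WindowClausePieces`) integrated over the window, for which § 1 supplies
the interval integrability of visibility-selected continuous one-body functionals along a good orbit (measurable in
time, positions in the compact torus, velocities in the energy ball).  The last bracket is the dropped-collisions
functional identified in `…WindowClauseCollisionalId` (M3).

STATEMENT NOTE (worker, plan → landed).  The plan's M4a had NO regularity on `lam0` and none on the reference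
parameters `ρs, us` of `VisibleN`; the splitting of the window integral `∫ Σᵢ kinᵢ = ∫ visKinN + ∫ Σ_invis kinᵢ`
needs both pieces interval integrable (Bochner junk otherwise), i.e. a locally bounded measurable `A₀ = ∇lam0` and a
measurable visibility event.  The landed statement adds `Measurable ρs`, `Measurable us`, `Torus.IsSmooth lam0` (in
4a-ii: `ρs = ρ_s`, `us = u_s` continuous, `lam0 = λ⁰_s` smooth) and drops the unused `0 < σ`, `ε_N < 1/2`; `τ` of
either sign or zero is allowed (an empty window makes every term vanish).  Nothing here restates the crux, a stub or
the Statement.  References: H.-T. Yau, Lett. Math. Phys. 22 (1991) § 2; S. Olla, S. R. S. Varadhan, H.-T. Yau,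
Commun. Math. Phys. 155 (1993) § 3.
-/

noncomputable section

open MeasureTheory Filter Set
open scoped ENNReal Topology InnerProductSpace BigOperators

namespace Summit.AtomisticToContinuum.HydrodynamicLimit.Theorems.LTEInBand

open Literature.MathematicalPhysics.KineticTheory Literature.Analysis.FluidPDE Literature.Analysis.FunctionSpaces

/-! ## § 1 Visibility-selected continuous one-body functionals along a good orbit are interval integrable -/

section Orbit

variable {σ : ℝ} {N : ℕ} {ρs : T3 → ℝ} {us : T3 → V3}

/-- Along a good orbit every velocity is bounded by the conserved kinetic energy: `‖vᵢ(r)‖ ≤ 1 + 2E(z)`. -/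
theorem norm_vel_flow_le_energy (Φ : HardSphereFlow (Torus.geometry (Fin 3)) (hsDiameter σ N) (N + 1))
    {z : Config (N + 1) (Fin 3) T3} (hz : z ∈ Φ.good) (r : ℝ) (i : Fin (N + 1)) :
    ‖(Φ.flow r z i).2‖ ≤ 1 + 2 * configEnergy z := by
  -- adapted from `ClampedCurrentsDockCollisionalIdPrelim.norm_vel_flow_le`
  have hE : configEnergy (Φ.flow r z) = configEnergy z := by
    have h := IsHardSphereTrajectory.configEnergy_eq_holds (Φ.isTrajectory z hz) r 0
    rwa [Φ.flow_zero z hz] at h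
  have h1 : ‖(Φ.flow r z i).2‖ ^ 2 ≤ ∑ j, ‖(Φ.flow r z j).2‖ ^ 2 :=
    Finset.single_le_sum (fun j _ => sq_nonneg ‖(Φ.flow r z j).2‖) (Finset.mem_univ i)
  have h2 : ∑ j, ‖(Φ.flow r z j).2‖ ^ 2 = 2 * configEnergy z := by
    rw [← hE, configEnergy]
    ring
  nlinarith [sq_nonneg (‖(Φ.flow r z i).2‖ - 1), norm_nonneg (Φ.flow r z i).2]

/-- **Visibility-selected continuous one-body functionals are interval integrable along a good orbit**: for `F`
continuous on `𝕋³ × ℝ³` and measurable reference parameters `ρs, us` of `VisibleN`, both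
`r ↦ Σ_(i visible) F(xᵢ(r), vᵢ(r))` and `r ↦ Σ_(i invisible) F(xᵢ(r), vᵢ(r))` are interval integrable on every `[a, b]`
(measurable in time — `IsHardSphereTrajectory.measurable_torus`, `measurableSet_visibleN` —, and bounded, the
positions ranging in the compact torus and the velocities in the energy ball). -/
theorem intervalIntegrable_sum_ite_visibleN_flow (hρm : Measurable ρs) (husm : Measurable us) (R K : ℝ)
    (Φ : HardSphereFlow (Torus.geometry (Fin 3)) (hsDiameter σ N) (N + 1)) {z : Config (N + 1) (Fin 3) T3}
    (hz : z ∈ Φ.good) {F : T3 × V3 → ℝ} (hF : Continuous F) (a b : ℝ) :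
    IntervalIntegrable (fun r => ∑ i, if VisibleN ρs us R K N (Φ.flow r z) i then F (Φ.flow r z i) else 0)
        volume a b ∧
      IntervalIntegrable (fun r => ∑ i, if VisibleN ρs us R K N (Φ.flow r z) i then 0 else F (Φ.flow r z i))
        volume a b := by
  obtain ⟨C, hC⟩ := (isCompact_univ.prod (isCompact_closedBall (0 : V3) (1 + 2 * configEnergy z)))
    |>.exists_bound_of_continuousOn hF.continuousOn
  have hγ : Measurable fun r : ℝ => Φ.flow r z := (Φ.isTrajectory z hz).measurable_torus
  have hFi : ∀ i : Fin (N + 1), Measurable fun r : ℝ => F (Φ.flow r z i) := fun i =>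
    hF.measurable.comp ((measurable_pi_apply i).comp hγ)
  have hVi : ∀ i : Fin (N + 1), MeasurableSet {r : ℝ | VisibleN ρs us R K N (Φ.flow r z) i} := fun i =>
    (measurableSet_visibleN hρm husm R K N i).preimage hγ
  have hbd : ∀ (r : ℝ) (i : Fin (N + 1)), ‖F (Φ.flow r z i)‖ ≤ C := fun r i =>
    hC _ (Set.mem_prod.2 ⟨mem_univ _, mem_closedBall_zero_iff.2 (norm_vel_flow_le_energy Φ hz r i)⟩)
  have hC0 : 0 ≤ C := (norm_nonneg _).trans (hbd a 0)
  have key : ∀ {f : ℝ → ℝ}, Measurable f → (∀ r, ‖f r‖ ≤ ∑ _i : Fin (N + 1), C) → IntervalIntegrable f volume a b :=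
    fun hm hb => by
      constructor <;> exact ⟨hm.aestronglyMeasurable, .of_bounded (ae_of_all _ hb)⟩
  constructor
  · refine key (Finset.measurable_sum _ fun i _ => Measurable.ite (hVi i) (hFi i) measurable_const) fun r =>
      (norm_sum_le _ _).trans (Finset.sum_le_sum fun i _ => ?_)
    split_ifs
    · exact hbd r i
    · simpa using hC0
  · refine key (Finset.measurable_sum _ fun i _ => Measurable.ite (hVi i) measurable_const (hFi i)) fun r =>
      (norm_sum_le _ _).trans (Finset.sum_le_sum fun i _ => ?_)
    split_ifs
    · simpa using hC0
    · exact hbd r i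

end Orbit

/-! ## § 2 M4a: the frozen split -/

section Split

variable {σ : ℝ} {N : ℕ}

/-- The one-particle kinetic current `kin(x, v) = ⟪A₀(x), v⟫ + Σ_j ⟪A_j(x), v⟫ v_j + ⟪A₄(x), v⟫ ‖v‖²/2` is continuous for
continuous test fields. -/
theorem continuous_kineticCurrent {A₀ A₄ : T3 → V3} {A : Fin 3 → T3 → V3} (hA₀ : Continuous A₀) (hA₄ : Continuous A₄)
    (hA : ∀ j, Continuous (A j)) :
    Continuous fun y : T3 × V3 =>
      ⟪A₀ y.1, y.2⟫_ℝ + (∑ j, ⟪A j y.1, y.2⟫_ℝ * y.2 j) + ⟪A₄ y.1, y.2⟫_ℝ * ‖y.2‖ ^ 2 / 2 :=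
  (((hA₀.comp continuous_fst).inner continuous_snd).add (continuous_finsetSum _ fun j _ =>
    (((hA j).comp continuous_fst).inner continuous_snd).mul ((PiLp.continuous_apply 2 _ j).comp continuous_snd))).add
    (((((hA₄.comp continuous_fst).inner continuous_snd).mul ((continuous_norm.comp continuous_snd).pow 2))).div_const _)

/-- **(M4a) The frozen split (pathwise identity on the good set)** — the algebraic skeleton of the one-block
decomposition of stub 4a-ii: with the profiles frozen at the window start `s` and the entropy-variable test fields
`(∇λ⁰, (∇(u_j/θ))_j, ∇(−θ⁻¹))`, the streaming integral of the one-particle kinetic current plus the frozen collision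
sum equal `w · visCoreN + ∫ visFluxN dr + ∫ Σ_(i invisible) kinᵢ dr + (dropped collisions)`
(`visCoreN_eq`, `sum_eq_sum_visible_add_sum_invisible` integrated with `intervalIntegrable_sum_ite_visibleN_flow`;
an empty window `w = 0` makes every term vanish).  The `∂ₜ`-part `∫ Σᵢ ∂ₜλ_s(xᵢ)·ηᵢ dr`, combined with `−∫ visFluxN dr`
by the Euler structure `∂ₜλ = −DF(U)ᵀ∇λ`, is the block Euler remainder of the plan. -/
theorem frozen_split (Φ : HardSphereFlow (Torus.geometry (Fin 3)) (hsDiameter σ N) (N + 1))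
    {ρs θ : T3 → ℝ} {us u : T3 → V3} {lam0 : T3 → ℝ} (hρm : Measurable ρs) (husm : Measurable us)
    (hlam : Torus.IsSmooth lam0) (hθ : Torus.IsSmooth θ) (hu : Torus.IsSmooth u) (hθ0 : ∀ x, 0 < θ x)
    (R K τ k s : ℝ) {z : Config (N + 1) (Fin 3) T3} (hz : z ∈ Φ.good) :
    (let w : ℝ := τ * ((N : ℝ) + 1) ^ (-(1 / 3 : ℝ))
     let A₀ : T3 → V3 := Torus.gradient lam0
     let A : Fin 3 → T3 → V3 := fun j => Torus.gradient fun x => u x j / θ x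
     let A₄ : T3 → V3 := Torus.gradient fun x => -(θ x)⁻¹
     let kin : T3 × V3 → ℝ := fun y => ⟪A₀ y.1, y.2⟫_ℝ + (∑ j, ⟪A j y.1, y.2⟫_ℝ * y.2 j) + ⟪A₄ y.1, y.2⟫_ℝ * ‖y.2‖ ^ 2 / 2
     let Ksf : HardSphereCollisionRecord (Fin 3) T3 (N + 1) → ℝ := fun c =>
       ((∑ k : Fin 3, (u c.fstPos k / θ c.fstPos - u c.sndPos k / θ c.sndPos) * (c.postVel.1 k - c.preVel.1 k)) -
         ((θ c.fstPos)⁻¹ - (θ c.sndPos)⁻¹) * ((‖c.postVel.1‖ ^ 2 - ‖c.preVel.1‖ ^ 2) / 2)) / 2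
     (∫ r in s..(s + w), ∑ i, kin (Φ.flow r z i)) + Φ.collisionSum (Set.Ioc s (s + w)) Ksf z =
       w * visCoreN σ ρs us A₀ A₄ A R K τ k N Φ s z +
         (∫ r in s..(s + w), visFluxN σ ρs us A₀ A₄ A R K k N (Φ.flow r z)) +
         (∫ r in s..(s + w), ∑ i, if VisibleN ρs us R K N (Φ.flow r z) i then 0 else kin (Φ.flow r z i)) +
         (Φ.collisionSum (Set.Ioc s (s + w)) Ksf z -
           ∑ᶠ r ∈ collisionTimes (Torus.geometry (Fin 3)) (hsDiameter σ N) (fun r' => Φ.flow r' z) ∩ Set.Ioc s (s + w),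
             visCollN σ ρs us A₄ A R K N (Function.leftLim (fun r' => Φ.flow r' z) r) (Φ.flow r z))) := by
  intro w A₀ A A₄ kin Ksf
  -- continuity of the test fields and of the kinetic current
  have hA₀c : Continuous A₀ := hlam.gradient.continuous
  have hAc : ∀ j, Continuous (A j) := fun j =>
    (show Torus.IsSmooth (fun x => u x j / θ x) from ContDiff.div (hu.apply j) hθ fun _ => (hθ0 _).ne').gradient.continuous
  have hA₄c : Continuous A₄ :=
    (show Torus.IsSmooth (fun x => -(θ x)⁻¹) from ContDiff.neg (ContDiff.inv hθ fun _ => (hθ0 _).ne')).gradient.continuous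
  have hkin : Continuous kin := continuous_kineticCurrent hA₀c hA₄c hAc
  -- the pointwise visible / invisible split and its integrated form
  have hsplit : ∀ y : Config (N + 1) (Fin 3) T3, ∑ i, kin (y i) =
      visKinN ρs us A₀ A₄ A R K N y + ∑ i, (if VisibleN ρs us R K N y i then 0 else kin (y i)) := fun y => by
    rw [sum_eq_sum_visible_add_sum_invisible ρs us R K N (fun i => kin (y i)) y]
    rfl
  obtain ⟨hI1, hI2⟩ := intervalIntegrable_sum_ite_visibleN_flow hρm husm R K Φ hz hkin s (s + w)
  have hI1' : IntervalIntegrable (fun r => visKinN ρs us A₀ A₄ A R K N (Φ.flow r z)) volume s (s + w) := hI1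
  have hint : (∫ r in s..(s + w), ∑ i, kin (Φ.flow r z i)) =
      (∫ r in s..(s + w), visKinN ρs us A₀ A₄ A R K N (Φ.flow r z)) +
        ∫ r in s..(s + w), ∑ i, if VisibleN ρs us R K N (Φ.flow r z) i then 0 else kin (Φ.flow r z i) := by
    rw [← intervalIntegral.integral_add hI1' hI2]
    exact intervalIntegral.integral_congr fun r _ => hsplit (Φ.flow r z)
  have hw : w = τ * ((N : ℝ) + 1) ^ (-(1 / 3 : ℝ)) := rfl
  rw [hint, visCoreN_eq, ← hw]
  by_cases hw0 : w = 0
  · rw [hw0, add_zero]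
    simp only [intervalIntegral.integral_same, Set.Ioc_self, Set.inter_empty, finsum_mem_empty]
    ring
  · rw [← mul_assoc, mul_inv_cancel₀ hw0, one_mul]
    ring

end Split

/-! ## The registered helper stub -/

/-- **Registered helper stub `stub_windowClauseFrozenSplit` (M4a of the plan of stub 4a-ii, skeleton v8, crux
stmt-17740)**: the frozen split `frozen_split` (with the measurability / smoothness hypotheses the plan's signature was
missing), restated with fully qualified names. -/
theorem stub_windowClauseFrozenSplit : ∀ (σ : ℝ) (N : ℕ) (Φ : Literature.Analysis.FluidPDE.HardSphereFlow (Literature.Analysis.FluidPDE.Torus.geometry (Fin 3)) (Literature.MathematicalPhysics.KineticTheory.hsDiameter σ N) (N + 1)) (ρs θ : Literature.MathematicalPhysics.KineticTheory.T3 → ℝ) (us u : Literature.MathematicalPhysics.KineticTheory.T3 → Literature.MathematicalPhysics.KineticTheory.V3) (lam0 : Literature.MathematicalPhysics.KineticTheory.T3 → ℝ), Measurable ρs → Measurable us → Literature.Analysis.FunctionSpaces.Torus.IsSmooth lam0 → Literature.Analysis.FunctionSpaces.Torus.IsSmooth θ → Literature.Analysis.FunctionSpaces.Torus.IsSmooth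 u → (∀ x, 0 < θ x) → ∀ (R K τ k s : ℝ) (z : Literature.Analysis.FluidPDE.Config (N + 1) (Fin 3) Literature.MathematicalPhysics.KineticTheory.T3), z ∈ Φ.good → (let w : ℝ := τ * ((N : ℝ) + 1) ^ (-(1 / 3 : ℝ)); let A₀ : Literature.MathematicalPhysics.KineticTheory.T3 → Literature.MathematicalPhysics.KineticTheory.V3 := Literature.Analysis.FunctionSpaces.Torus.gradient lam0; let A : Fin 3 → Literature.MathematicalPhysics.KineticTheory.T3 → Literature.MathematicalPhysics.KineticTheory.V3 := fun j => Literature.Analysis.FunctionSpaces.Torus.gradient fun x => u x j / θ x; let A₄ : Literature.MathematicalPhysics.KineticTheory.T3 → Literature.MathematicalPhysics.KineticTheory.V3 := Literature.Analysis.FunctionSpaces.Torus.gradient fun x => -(θ x)⁻¹; let kin : Literature.MathematicalPhysics.KineticTheory.T3 × Literature.MathematicalPhysics.KineticTheory.V3 → ℝ := fun y => inner ℝ (A₀ y.1) y.2 + (∑ j, inner ℝ (A j y.1) y.2 * y.2 j) + inner ℝ (A₄ y.1) y.2 * ‖y.2‖ ^ 2 / 2; let Ksf : Literature.Analysis.FluidPDE.HardSphereCollisionRecord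 (Fin 3) Literature.MathematicalPhysics.KineticTheory.T3 (N + 1) → ℝ := fun c => ((∑ k : Fin 3, (u c.fstPos k / θ c.fstPos - u c.sndPos k / θ c.sndPos) * (c.postVel.1 k - c.preVel.1 k)) - ((θ c.fstPos)⁻¹ - (θ c.sndPos)⁻¹) * ((‖c.postVel.1‖ ^ 2 - ‖c.preVel.1‖ ^ 2) / 2)) / 2; (∫ r in s..(s + w), ∑ i, kin (Φ.flow r z i)) + Φ.collisionSum (Set.Ioc s (s + w)) Ksf z = w * Summit.AtomisticToContinuum.HydrodynamicLimit.Theorems.LTEInBand.visCoreN σ ρs us A₀ A₄ A R K τ k N Φ s z + (∫ r in s..(s + w), Summit.AtomisticToContinuum.HydrodynamicLimit.Theorems.LTEInBand.visFluxN σ ρs us A₀ A₄ A R K k N (Φ.flow r z)) + (∫ r in s..(s + w), ∑ i, if Summit.AtomisticToContinuum.HydrodynamicLimit.Theorems.LTEInBand.VisibleN ρs us R K N (Φ.flow r z) i then 0 else kin (Φ.flow r z i)) + (Φ.collisionSum (Set.Ioc s (s + w)) Ksf z - ∑ᶠ r ∈ Literature.Analysis.FluidPDE.collisionTimes (Literature.Analysis.FluidPDE.Torus.geometry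 (Fin 3)) (Literature.MathematicalPhysics.KineticTheory.hsDiameter σ N) (fun r' => Φ.flow r' z) ∩ Set.Ioc s (s + w), Summit.AtomisticToContinuum.HydrodynamicLimit.Theorems.LTEInBand.visCollN σ ρs us A₄ A R K N (Function.leftLim (fun r' => Φ.flow r' z) r) (Φ.flow r z))) :=
  fun _ _ Φ _ _ _ _ _ hρm husm hlam hθ hu hθ0 R K τ k s _ hz =>
    frozen_split Φ hρm husm hlam hθ hu hθ0 R K τ k s hz

end Summit.AtomisticToContinuum.HydrodynamicLimit.Theorems.LTEInBand

end
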